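import Summits.ResolutionOfSingularities.ResolutionOfSingularities.Theorems.WeightedInvariantIotaLex
import Summits.ResolutionOfSingularities.ResolutionOfSingularities.Theorems.WeightedInvariantIotaOrderEquimultipleCentre
import Summits.ResolutionOfSingularities.ResolutionOfSingularities.Theorems.WeightedInvariantContactCylinderDefs
import HarnessLib

/-!
# The P3 letter `ε` of `ι₃ = (ν ; ε ; σ)`: «is the equimultiple locus a permissible centre?» — typed, with its (c6) / (c12a)
# invariance and the pair `iotaOrdEps = (iotaOrd, iotaEps)` — door `HypersurfaceCentreConstruction`
# (stmt-ResolutionOfSingularities-19897), route `WeightedInvariant`, rung P3, ORDER (o32-ι-a)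

[OURS · L1 W4.3 · cell `res-hironaka`, HUMAN RULING D-0089] Helper file `--supports stmt-ResolutionOfSingularities-19897`,
typer res-type-013 on res-L1-w43-plan-1's ORDER (o32-ι-a) «P3 LETTERS, TYPED» (HOME/STATUS 2026-08-27T11:00:43Z, DEALS gen 10
#6 (3)), after the two design inputs INPUT A (res-type-078, `plan/tools/res-type-078/p3/IOTA3-INPUT.md` v1.1 §1: the letter `ε`;
kernel p524107 `…IotaOrderEquimultipleCentre`) and INPUT B (res-type-073, `plan/tools/res-type-073/p3/IOTA3-PROBE.md` v1.1: the
candidate `ι_♭ = (ν ; ε ; σ)`).  CANDIDATE DESIGN OBJECTS ONLY: nothing here is a statement of the manuscript under review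
(Hironaka 2017, [claim: Hironaka2017, status: under-review]); nothing is attributed to its author; nothing here claims anything
about resolution of singularities; `iotaEps` / `iotaOrdEps` are NOT offered as the witness of the conjecture `LocalWeightedDropEFT4S`.
AI typing, weaker than expert review.

## The letter

For a position `(R, g)` the EQUIMULTIPLE (equal-order) LOCUS through the closed point is the tree's top stratum of the order
function, `ContactCylinder.topStratum iotaOrd R g = {𝔮 : Spec R | ord_{R_𝔮}(g) = ord_R(g)}` (res-type-005, (o28) (D1), p524206;
for a non-unit `g` of a local ring every such `𝔮` contains `g`, `mem_asIdeal_of_mem_topStratum_iotaOrd`, so this IS INPUT A's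
`Σ(S,f) = {𝔭 ∋ f : ord_{S_𝔭} f = ord_S f}`).  INPUT A's letter:

* `IsPermissibleEquimultipleLocus R g` — «`Σ(R,g) = V(P)` for a prime `P` with `R ⧸ P` a regular local ring» (`P = 𝔪` allowed:
  the stratum is the closed point alone); off the local rings the predicate is junk (as `iotaOrd` is).
* `iotaEps R g : Ordinal` — `0` if `IsPermissibleEquimultipleLocus R g`, else `1` (INPUT A §1 «ε(S,f) := 0 if Σ(S,f) = V(P) …
  with S ⧸ P regular, else 1»).
* `iotaOrdEps := iotaLex ω iotaOrd iotaEps` — the pair `(ν ; ε)` read in `Ordinal` (res-type-073's combinator, p504861), the first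
  two letters of INPUT B's `ι_♭ = (ν ; ε ; σ)`; res-type-073's (o32-ι-b) file nests the third letter on top of it.

## What is proved (definitions + plumbing; no new mathematics)

* `iotaEps_isoInvariant : IotaIsoInvariant iotaEps` — (c6): a ring isomorphism `e : R ≃+* T` carries primes to primes
  (`Ideal.map`/`comap`), `R ⧸ P ≃ T ⧸ e(P)` (`Ideal.quotientEquiv`), `R_{e⁻¹𝔮} ≃ T_𝔮` (`IsLocalization.ringEquivOfRingEquiv`), and
  `iotaOrd` is iso-invariant (res-type-073, p502169), so the equimultiple locus and its permissibility are transported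
  (`mem_topStratum_iotaOrd_comap_iff`, `isPermissibleEquimultipleLocus_of_ringEquiv`);
* `iotaEps_unitInvariant : IotaUnitInvariant iotaEps` — (c12a): `Σ(R, v·g) = Σ(R, g)` for a unit `v`
  (`topStratum_iotaOrd_unit_mul`, from `iotaOrd_unitInvariant`);
* `iotaEps_boundedBy : IotaBoundedBy 2 iotaEps`, `iotaEps_boundedBy_omega0` — the letter takes the values `0`, `1` only;
* `iotaOrdEps_isoInvariant`, `iotaOrdEps_unitInvariant`, `iotaOrdEps_boundedBy`, `iotaOrdEps_lt_iff`, `iotaOrdEps_eq_iff` — the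
  pair's (c6)/(c12a) (res-type-073's `iotaLex_isoInvariant` / `iotaLex_unitInvariant`), its bound `ω·(ω+1)` for further nesting,
  and the (strat)/(drop) currency;
* `topStratumPrime_eq_of_isPermissibleEquimultipleLocus`, `mem_pow_of_isPermissibleEquimultipleLocus` — the link to (o28)'s
  cylinder prime (`ContactCylinder.topStratumPrime iotaOrd R g = P`) and, on a REGULAR local ring, to res-type-078's equimultiplicity
  criterion (`f ∈ P^ν`, p524107 `mem_pow_of_iotaOrd_localization_eq`), i.e. the (adm) input of `CanonicalGameClause` along `V(P)`.

The stratum-relative clauses (c7)↾, (c8)↾, (c10)↾, (c11)↾ of the SECOND key (res-type-073's `IotaGenerizationMonotoneOn` &c.) are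
NOT in this file: they are the research content of INPUT A §2 and come with IOTA3-DESIGN v1.

## References

* res-type-078, `IOTA3-INPUT.md` v1.1 (INPUT A of ORDER (o30); OURS, AI design input); res-type-073, `IOTA3-PROBE.md` v1.1 (INPUT B).
* res-L1-w43-plan-1, HOME/STATUS 2026-08-27T11:00:43Z DEALS gen 10 #6 (3) (ORDER (o32-ι-a); OURS, AI planning).
* O. Zariski, P. Samuel, *Commutative Algebra* II, Ch. VIII §1 (order along a prime of a regular local ring). [ZariskiSamuel1960]
-/

noncomputable section

set_option linter.dupNamespace false -- mandated namespace `Summit.<Summit>.<Problem>` of this single-conjunct summit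

open IsLocalRing
open Summit.ResolutionOfSingularities.ResolutionOfSingularities.Theorems (ContactCylinder.topStratum ContactCylinder.topStratumPrime)

namespace Summit.ResolutionOfSingularities.ResolutionOfSingularities.Cruxes.HypersurfaceCentreConstruction.LocalEngine

namespace Iota3

open Summit.ResolutionOfSingularities.ResolutionOfSingularities.Theorems.ContactCylinder

/-! ## The equimultiple locus: the top stratum of the order function -/

/-- In a LOCAL ring, every prime of the equimultiple locus of a NON-UNIT `g` contains `g` (at a prime `𝔮 ∌ g` the image of `g`
is a unit of `R_𝔮`, of order `0 < ord_R g`).  So `ContactCylinder.topStratum iotaOrd R g` is INPUT A's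
`Σ(R,g) = {𝔭 ∋ g : ord_{R_𝔭} g = ord_R g}`. [OURS] -/
theorem mem_asIdeal_of_mem_topStratum_iotaOrd (R : Type) [CommRing R] [IsLocalRing R] {g : R} (hg : g ∈ maximalIdeal R)
    {𝔮 : PrimeSpectrum R} (h𝔮 : 𝔮 ∈ topStratum iotaOrd R g) : g ∈ 𝔮.asIdeal := by
  by_contra hng
  rw [mem_topStratum_iff] at h𝔮
  -- `g` is a unit at `𝔮`, so its order there is `0`
  have hunit : IsUnit (algebraMap R (Localization.AtPrime 𝔮.asIdeal) g) :=
    IsLocalization.map_units (Localization.AtPrime 𝔮.asIdeal) ⟨g, show g ∈ 𝔮.asIdeal.primeCompl from hng⟩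
  have h0 : iotaOrd (Localization.AtPrime 𝔮.asIdeal) (algebraMap R (Localization.AtPrime 𝔮.asIdeal) g) = 0 := by
    have h := iotaOrd_unitInvariant (Localization.AtPrime 𝔮.asIdeal)
      (algebraMap R (Localization.AtPrime 𝔮.asIdeal) g) 1 hunit
    rw [mul_one] at h
    rw [h, (iotaOrd_eq_natCast_iff _ (1 : Localization.AtPrime 𝔮.asIdeal) 0).mpr]
    · simp
    · refine ⟨by simp, fun hmem => ?_⟩
      rw [zero_add, pow_one] at hmem
      exact (IsLocalRing.maximalIdeal.isMaximal _).ne_top (Ideal.eq_top_of_isUnit_mem _ hmem isUnit_one)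
  -- but at the closed point the order is `≥ 1`
  have h1 : (1 : Ordinal) ≤ iotaOrd R g := by
    have h := (natCast_le_iotaOrd_iff R g 1).mpr (by rw [pow_one]; exact hg)
    exact_mod_cast h
  rw [h𝔮] at h0
  rw [h0] at h1
  exact absurd h1 (by simp)

/-- **(c12a) for the equimultiple locus**: `Σ(R, v·g) = Σ(R, g)` for a unit `v` (the order function is unit-invariant at `R` and at
every `R_𝔮`). [OURS] -/
theorem topStratum_iotaOrd_unit_mul (R : Type) [CommRing R] {v : R} (hv : IsUnit v) (g : R) :
    topStratum iotaOrd R (v * g) = topStratum iotaOrd R g := by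
  ext 𝔮
  rw [mem_topStratum_iff, mem_topStratum_iff, map_mul,
    iotaOrd_unitInvariant (Localization.AtPrime 𝔮.asIdeal) _ _ (hv.map (algebraMap R (Localization.AtPrime 𝔮.asIdeal))),
    iotaOrd_unitInvariant R v g hv]

/-- **(c6) for the equimultiple locus**: along a ring isomorphism `e : R ≃+* T`, a prime `𝔮` of `T` lies in `Σ(T, e g)` iff
`e⁻¹𝔮` lies in `Σ(R, g)` (`R_{e⁻¹𝔮} ≃ T_𝔮` by `IsLocalization.ringEquivOfRingEquiv`, and the order function is iso-invariant). [OURS] -/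
theorem mem_topStratum_iotaOrd_comap_iff {R T : Type} [CommRing R] [CommRing T] (e : R ≃+* T) (g : R) (𝔮 : PrimeSpectrum T) :
    (⟨𝔮.asIdeal.comap e, Ideal.comap_isPrime e 𝔮.asIdeal⟩ : PrimeSpectrum R) ∈ topStratum iotaOrd R g ↔
      𝔮 ∈ topStratum iotaOrd T (e g) := by
  rw [mem_topStratum_iff, mem_topStratum_iff]
  -- the induced isomorphism of localizations
  let eloc : Localization.AtPrime (𝔮.asIdeal.comap e) ≃+* Localization.AtPrime 𝔮.asIdeal :=
    IsLocalization.ringEquivOfRingEquiv (Localization.AtPrime (𝔮.asIdeal.comap e))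
      (Localization.AtPrime 𝔮.asIdeal) e (e.map_primeCompl_comap_eq 𝔮.asIdeal)
  have heloc : eloc (algebraMap R (Localization.AtPrime (𝔮.asIdeal.comap e)) g) =
      algebraMap T (Localization.AtPrime 𝔮.asIdeal) (e g) :=
    IsLocalization.ringEquivOfRingEquiv_eq (e.map_primeCompl_comap_eq 𝔮.asIdeal) g
  have h1 : iotaOrd (Localization.AtPrime (𝔮.asIdeal.comap e))
      (algebraMap R (Localization.AtPrime (𝔮.asIdeal.comap e)) g) =
      iotaOrd (Localization.AtPrime 𝔮.asIdeal) (algebraMap T (Localization.AtPrime 𝔮.asIdeal) (e g)) := by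
    rw [← heloc, iotaOrd_isoInvariant _ _ eloc]
  change iotaOrd (Localization.AtPrime (𝔮.asIdeal.comap e))
      (algebraMap R (Localization.AtPrime (𝔮.asIdeal.comap e)) g) = iotaOrd R g ↔ _
  rw [h1, iotaOrd_isoInvariant R T e g]

/-! ## Permissibility of the equimultiple locus and the letter `ε` -/

/-- [OURS · candidate · INPUT A §1] **The equimultiple locus is a permissible centre**: `Σ(R, g) = V(P)` for some prime `P` of `R` with
`R ⧸ P` a regular local ring (`P = 𝔪`: the top stratum is the closed point alone).  Junk off the local rings (as `iotaOrd`). -/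
def IsPermissibleEquimultipleLocus (R : Type) [CommRing R] (g : R) : Prop :=
  ∃ (P : Ideal R) (_ : P.IsPrime), IsRegularLocalRing (R ⧸ P) ∧ topStratum iotaOrd R g = {𝔮 | P ≤ 𝔮.asIdeal}

open Classical in
/-- [OURS · candidate · INPUT A §1, ORDER (o32-ι-a)] **The letter `ε` of `ι₃`**, read in `Ordinal`: `0` if the equimultiple locus of
`(R, g)` is a permissible centre (`IsPermissibleEquimultipleLocus`), `1` otherwise.  Binder shape
`(R : Type) → [CommRing R] → R → Ordinal.{0}` of the clauses of `…HypersurfaceLocalGameEFT3`. -/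
def iotaEps (R : Type) [CommRing R] (g : R) : Ordinal.{0} :=
  if IsPermissibleEquimultipleLocus R g then 0 else 1

/-- Unfolding: `ε = 0` iff the equimultiple locus is a permissible centre. [OURS] -/
theorem iotaEps_eq_zero_iff (R : Type) [CommRing R] (g : R) : iotaEps R g = 0 ↔ IsPermissibleEquimultipleLocus R g := by
  unfold iotaEps
  split_ifs with h
  · simp [h]
  · simp [h]

/-- Unfolding: `ε = 1` iff the equimultiple locus is NOT a permissible centre. [OURS] -/
theorem iotaEps_eq_one_iff (R : Type) [CommRing R] (g : R) : iotaEps R g = 1 ↔ ¬ IsPermissibleEquimultipleLocus R g := by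
  unfold iotaEps
  split_ifs with h
  · simp [h]
  · simp [h]

/-- `ε ∈ {0, 1}`. [OURS] -/
theorem iotaEps_eq_zero_or_eq_one (R : Type) [CommRing R] (g : R) : iotaEps R g = 0 ∨ iotaEps R g = 1 := by
  unfold iotaEps
  split_ifs
  · exact Or.inl rfl
  · exact Or.inr rfl

/-- `ε < 2`: the letter is bounded by `2` (so it can be the second key of a lexicographic pair with any base `Λ ≥ 2`). [OURS] -/
theorem iotaEps_boundedBy : IotaBoundedBy 2 iotaEps := by
  intro R _ g
  rcases iotaEps_eq_zero_or_eq_one R g with h | h <;> rw [h]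
  · exact zero_lt_two
  · exact one_lt_two

/-- `ε < ω` (the base used by ORDER (o32-ι-a) for the pair `(ν ; ε)`). [OURS] -/
theorem iotaEps_boundedBy_omega0 : IotaBoundedBy Ordinal.omega0 iotaEps := fun R _ g =>
  (iotaEps_boundedBy R g).trans (Ordinal.natCast_lt_omega0 2)

/-- **BRIDGE TO THE (strat) SHAPE** (the form of res-type-078's draft `OrdStratumPermissible` and of the (strat) conjunct of
`CanonicalGameClause` for `ι = iotaOrd`): for a NON-UNIT `g` of a local ring, the equimultiple locus is a permissible centre iff some prime
`P ∋ g` with `R ⧸ P` regular cuts out, among the primes `𝔭 ∋ g`, exactly those where `g` keeps its order. [OURS] -/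
theorem isPermissibleEquimultipleLocus_iff_strat (R : Type) [CommRing R] [IsLocalRing R] {g : R} (hg : g ∈ maximalIdeal R) :
    IsPermissibleEquimultipleLocus R g ↔
      ∃ P : Ideal R, P.IsPrime ∧ IsRegularLocalRing (R ⧸ P) ∧ g ∈ P ∧
        ∀ (𝔭 : Ideal R) [𝔭.IsPrime], g ∈ 𝔭 →
          (iotaOrd (Localization.AtPrime 𝔭) (algebraMap R (Localization.AtPrime 𝔭) g) = iotaOrd R g ↔ P ≤ 𝔭) := by
  constructor
  · rintro ⟨P, hP, hreg, hS⟩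
    have hmemP : (⟨P, hP⟩ : PrimeSpectrum R) ∈ topStratum iotaOrd R g := by rw [hS]; exact (le_rfl : P ≤ P)
    refine ⟨P, hP, hreg, mem_asIdeal_of_mem_topStratum_iotaOrd R hg hmemP, fun 𝔭 _ _ => ?_⟩
    rw [← mem_topStratum_iff iotaOrd R g ⟨𝔭, inferInstance⟩, hS]
    rfl
  · rintro ⟨P, hP, hreg, hgP, hiff⟩
    refine ⟨P, hP, hreg, Set.ext fun 𝔮 => ?_⟩
    simp only [Set.mem_setOf_eq]
    by_cases hg𝔮 : g ∈ 𝔮.asIdeal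
    · rw [mem_topStratum_iff]
      exact hiff 𝔮.asIdeal hg𝔮
    · constructor
      · exact fun h => absurd (mem_asIdeal_of_mem_topStratum_iotaOrd R hg h) hg𝔮
      · exact fun h => absurd (h hgP) hg𝔮

/-! ## (c6) iso-invariance and (c12a) unit-invariance of `ε` -/

/-- Transport of permissibility along a ring isomorphism (one direction; the other is the same statement for `e.symm`). [OURS] -/
theorem isPermissibleEquimultipleLocus_of_ringEquiv {R T : Type} [CommRing R] [CommRing T] (e : R ≃+* T) (g : R)
    (h : IsPermissibleEquimultipleLocus R g) : IsPermissibleEquimultipleLocus T (e g) := by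
  obtain ⟨P, hP, hreg, hS⟩ := h
  haveI : (P.map (e : R →+* T)).IsPrime := Ideal.map_isPrime_of_equiv e
  refine ⟨P.map (e : R →+* T), inferInstance, ?_, ?_⟩
  · -- `R ⧸ P ≃ T ⧸ e(P)`
    exact IsRegularLocalRing.of_ringEquiv (Ideal.quotientEquiv P (P.map (e : R →+* T)) e rfl)
  · ext 𝔮
    rw [← mem_topStratum_iotaOrd_comap_iff e g 𝔮, hS]
    simp only [Set.mem_setOf_eq]
    rw [Ideal.map_le_iff_le_comap]
    exact Iff.rfl

/-- Permissibility of the equimultiple locus is invariant under ring isomorphisms. [OURS] -/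
theorem isPermissibleEquimultipleLocus_iff_of_ringEquiv {R T : Type} [CommRing R] [CommRing T] (e : R ≃+* T) (g : R) :
    IsPermissibleEquimultipleLocus T (e g) ↔ IsPermissibleEquimultipleLocus R g := by
  refine ⟨fun h => ?_, isPermissibleEquimultipleLocus_of_ringEquiv e g⟩
  have h' := isPermissibleEquimultipleLocus_of_ringEquiv e.symm (e g) h
  rwa [e.symm_apply_apply] at h'

/-- **(c6) for `ε`**: `IotaIsoInvariant iotaEps`. [OURS] -/
theorem iotaEps_isoInvariant : IotaIsoInvariant iotaEps := by
  intro R T _ _ e g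
  unfold iotaEps
  rw [show (IsPermissibleEquimultipleLocus T (e g) ↔ IsPermissibleEquimultipleLocus R g) from
    isPermissibleEquimultipleLocus_iff_of_ringEquiv e g]

/-- Permissibility of the equimultiple locus is invariant under unit multiples. [OURS] -/
theorem isPermissibleEquimultipleLocus_unit_mul (R : Type) [CommRing R] {v : R} (hv : IsUnit v) (g : R) :
    IsPermissibleEquimultipleLocus R (v * g) ↔ IsPermissibleEquimultipleLocus R g := by
  unfold IsPermissibleEquimultipleLocus
  rw [topStratum_iotaOrd_unit_mul R hv g]

/-- **(c12a) for `ε`**: `IotaUnitInvariant iotaEps`. [OURS] -/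
theorem iotaEps_unitInvariant : IotaUnitInvariant iotaEps := by
  intro R _ v g hv
  unfold iotaEps
  rw [show (IsPermissibleEquimultipleLocus R (v * g) ↔ IsPermissibleEquimultipleLocus R g) from
    isPermissibleEquimultipleLocus_unit_mul R hv g]

/-! ## Links: the cylinder prime of (o28), and equimultiplicity along the centre (INPUT A's kernel (B)) -/

/-- When `ε = 0` with witness `P`, the generic prime of the top `iotaOrd`-stratum of (o28) (`ContactCylinder.topStratumPrime`) IS `P`.
[OURS] -/
theorem topStratumPrime_eq_of_topStratum_eq (R : Type) [CommRing R] (g : R) {P : Ideal R} [P.IsPrime]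
    (hS : topStratum iotaOrd R g = {𝔮 | P ≤ 𝔮.asIdeal}) : topStratumPrime iotaOrd R g = P :=
  Summit.ResolutionOfSingularities.ResolutionOfSingularities.Theorems.ContactCylinder.topStratumPrime_eq_of_topStratum_eq
    iotaOrd R g hS

/-- When `ε = 0`, the generic prime `P₀ = topStratumPrime iotaOrd R g` of the top stratum is prime, `R ⧸ P₀` is a regular local
ring and `Σ(R, g) = V(P₀)` — the witness is canonical. [OURS] -/
theorem topStratumPrime_spec_of_isPermissibleEquimultipleLocus (R : Type) [CommRing R] (g : R)
    (h : IsPermissibleEquimultipleLocus R g) :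
    ∃ (_ : (topStratumPrime iotaOrd R g).IsPrime), IsRegularLocalRing (R ⧸ topStratumPrime iotaOrd R g) ∧
      topStratum iotaOrd R g = {𝔮 | topStratumPrime iotaOrd R g ≤ 𝔮.asIdeal} := by
  obtain ⟨P, hP, hreg, hS⟩ := h
  have hP₀ : topStratumPrime iotaOrd R g = P := topStratumPrime_eq_of_topStratum_eq R g hS
  rw [hP₀]
  exact ⟨hP, hreg, hS⟩

/-- **Equimultiplicity along the permissible centre** (INPUT A's kernel (B), res-type-078 p524107, read at `ε = 0`): in a REGULAR local
ring, if `Σ(S, f) = V(P)` with `S ⧸ P` regular and `f` has order `ν`, then `f ∈ P ^ ν` — the (adm) input of `CanonicalGameClause`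
along `V(P)` (`EquimultipleCentre.adm_of_mem_pow`). [cite: ZariskiSamuel1960, Ch. VIII §1 Thm. 1] -/
theorem mem_pow_of_topStratum_eq {S : Type} [CommRing S] [IsRegularLocalRing S] {f : S} {ν : ℕ} (hν : iotaOrd S f = ν)
    {P : Ideal S} [P.IsPrime] (hreg : IsRegularLocalRing (S ⧸ P)) (hS : topStratum iotaOrd S f = {𝔮 | P ≤ 𝔮.asIdeal}) :
    f ∈ P ^ ν := by
  haveI := hreg
  have hmem : (⟨P, inferInstance⟩ : PrimeSpectrum S) ∈ topStratum iotaOrd S f := by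
    rw [hS]; exact (le_rfl : P ≤ P)
  exact EquimultipleCentre.mem_pow_of_iotaOrd_localization_eq P hν ((mem_topStratum_iff iotaOrd S f _).mp hmem)

/-! ## The pair `(ν ; ε)` -/

/-- [OURS · candidate · ORDER (o32-ι-a)] **The first two letters of `ι₃`**: `iotaOrdEps = iotaLex ω iotaOrd iotaEps = ω·ord + ε`
(res-type-073's lexicographic combinator; the pair is read lexicographically since `ε < ω`). -/
def iotaOrdEps : (R : Type) → [CommRing R] → R → Ordinal.{0} :=
  iotaLex Ordinal.omega0 iotaOrd iotaEps

/-- Unfolding. [OURS] -/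
theorem iotaOrdEps_apply (R : Type) [CommRing R] (g : R) : iotaOrdEps R g = Ordinal.omega0 * iotaOrd R g + iotaEps R g := rfl

/-- **(c6) for the pair**: `IotaIsoInvariant iotaOrdEps`. [OURS] -/
theorem iotaOrdEps_isoInvariant : IotaIsoInvariant iotaOrdEps :=
  iotaLex_isoInvariant iotaOrd_isoInvariant iotaEps_isoInvariant

/-- **(c12a) for the pair**: `IotaUnitInvariant iotaOrdEps`. [OURS] -/
theorem iotaOrdEps_unitInvariant : IotaUnitInvariant iotaOrdEps :=
  iotaLex_unitInvariant iotaOrd_unitInvariant iotaEps_unitInvariant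

/-- The pair is bounded by `ω·(ω+1)` (for nesting a third letter ON TOP of it one uses `iotaLex Λ iotaOrdEps ι₃`, where no bound on the
first key is needed; this bound serves pairings in which `(ν ; ε)` is the SECOND key). [OURS] -/
theorem iotaOrdEps_boundedBy : IotaBoundedBy (Ordinal.omega0 * (Ordinal.omega0 + 1)) iotaOrdEps :=
  iotaLex_boundedBy iotaOrd_boundedBy iotaEps_boundedBy_omega0

/-- (strat)/(drop) currency for the pair: it drops iff the order drops, or the order is kept and `ε` drops (`1 ↦ 0`). [OURS] -/
theorem iotaOrdEps_lt_iff (R : Type) [CommRing R] (g : R) (R' : Type) [CommRing R'] (g' : R') :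
    iotaOrdEps R g < iotaOrdEps R' g' ↔
      iotaOrd R g < iotaOrd R' g' ∨ (iotaOrd R g = iotaOrd R' g' ∧ iotaEps R g < iotaEps R' g') :=
  iotaLex_lt_iff iotaEps_boundedBy_omega0 R g R' g'

/-- The pair is stationary iff both letters are. [OURS] -/
theorem iotaOrdEps_eq_iff (R : Type) [CommRing R] (g : R) (R' : Type) [CommRing R'] (g' : R') :
    iotaOrdEps R g = iotaOrdEps R' g' ↔ iotaOrd R g = iotaOrd R' g' ∧ iotaEps R g = iotaEps R' g' :=
  iotaLex_eq_iff iotaEps_boundedBy_omega0 R g R' g'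

/-- Weak comparison of pairs. [OURS] -/
theorem iotaOrdEps_le_iff (R : Type) [CommRing R] (g : R) (R' : Type) [CommRing R'] (g' : R') :
    iotaOrdEps R g ≤ iotaOrdEps R' g' ↔
      iotaOrd R g < iotaOrd R' g' ∨ (iotaOrd R g = iotaOrd R' g' ∧ iotaEps R g ≤ iotaEps R' g') :=
  iotaLex_le_iff iotaEps_boundedBy_omega0 R g R' g'

end Iota3

end Summit.ResolutionOfSingularities.ResolutionOfSingularities.Cruxes.HypersurfaceCentreConstruction.LocalEngine

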